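import Summits.QuantumFields.BalabanUV.T4Continuum.Support.NE7EnergySliceLocalForm
import Summits.QuantumFields.BalabanUV.T4Continuum.Support.NE3CovariantBlockDivergence
import Summits.QuantumFields.BalabanUV.T4Continuum.Support.NE3NestedBlockMeanBridge
import Summits.QuantumFields.BalabanUV.T4Continuum.Support.NE3LandauOrbit
import Summits.QuantumFields.BalabanUV.T4Continuum.Support.PeriodicChoice
import HarnessLib

/-!
# NE7EnergySliceDivergenceSup — THE LAGRANGE MULTIPLIER OF THE ENERGY SLICE IS `O(sup∕M)`: for `Y ∈ 𝒯_E(W) = energyBlockLandauW L N (k+1) W` with `sup‖Y‖ ≤ S`,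
# the covariant divergence `D_W^*Y` (a nested transported block constant, `NE7EnergySliceLocalForm`) and its nested block mean satisfy
# `‖covDiv W Y (y)‖, ‖bmeanIterW (covDiv W Y) (z)‖ ≤ 2(2d + 4d(d−1)·M²x)·S∕M` (`M = L^{k+1}`, `x` the plaquette radius) — k- and N-free

Cell `pub-balaban`, rung (B)+1 sub-cell t4, lineage `b2b-balaban-t4-ne7-p1`, generation 101 (CRUX PROVER NE7 #1 = OWNER of BINDER row NE7).  Memo
`t4/b2b-balaban-t4-ne7-p1-g101/ROAD-G101.md` §2: brick (B1) of THE CURVED SUP LETTER (L) (memo ROAD-G100 §4 step (4)): in the local bootstrap the divergence of the cut-off,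
axially gauged slice element is its covariant divergence `κ = D_W^*Y` up to `O(a·S)`, and `κ` enters the flat re-projection's source only through its distance from FLAT block
constants, `≲ (a₀ + 1∕K₀)·sup‖κ‖`; the gain `1∕M` proved here is what makes that term absorbable.
THE ARGUMENT (no duality, no Green's function).  (1) For ANY bond field `η` with `sup‖η‖ ≤ S` and any unitary `W` with `SmallField W a`: the tree-transported block mean of the
covariant divergence is a BOUNDARY FLUX plus loop defects — row NE3's covariant block divergence theorem `NE3CovariantBlockDivergence.sum_Ad_btree_covDiv_eq` (exact identity (A):
`Σ_{v∈B} Ad_{btree} covDiv W η = Σ_κ (farFlux − farDefect − nearFlux) + combDefect`) with its first-order defect bounds (`norm_combDefect_le`, `norm_farDefect_le`); the two fluxes are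
sums of `M^{d−1}` unitary transports of bond values, so `‖bmeanW M W (covDiv W η) z‖ ≤ (2d + 4d(d−1)(M−1)M·a)·S∕M` (§1).  (2) For `Y ∈ 𝒯_E(W)`: `covDiv W Y = nestedExt(g)`,
`g := bmeanIterW L (k+1) W (covDiv W Y)` (local form `covDiv_eq_nestedExt_of_mem`), so `sup‖covDiv W Y‖ ≤ Γ := sup‖g‖` (`norm_nestedExt_le`; `g` is `N`-periodic by
`bmeanIterW_skew_periodic`, the sup is attained); the nested∕single bridge `NE3NestedBlockMeanBridge.norm_bmeanIterW_sub_bmeanW_le` gives `‖g z − bmeanW M W (covDiv W Y) z‖ ≤ θ_P·Γ`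
with the Poincaré parameter `θ_P = 4d²(M−1)²x + 16d·loopRad ≤ 1∕2`; hence `Γ ≤ θ_PΓ + (2d + 4d(d−1)M²x)S∕M`, i.e. `Γ ≤ 2(2d + 4d(d−1)M²x)·S∕M` (§2).
WHAT ([folklore]; 0 def, 0 sorry; dimension `d ≥ 1`).  §1 `norm_sum_face_le`, `bmeanW_eq_sum_btree`, **`norm_bmeanW_covDiv_le`** (any `η`, any unitary small-field `W`, any block side
`M ≥ 1`).  §2 **`divergence_sup_le`** (the two displayed bounds for `Y ∈ 𝒯_E(W)`, `L ≥ 2`, multi-level small-field class at level `k+1`).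
HONEST FRAMING (page 1): a linear lattice estimate on OUR typed objects BY NAME over row NE3's block divergence theorem and bridge; nothing of Bałaban's asserted ([B8] (1.38) and
[Balaban1985Averaging] (42) are TEXT LOCATIONS); THE CURVED LETTER (L) IS NOT PROVED HERE (brick (B1) only); NOT (S1), NOT NE7; spine 0∕9; finite T⁴ rung (B)+1 — NOT infinite
volume, NOT mass gap, NOT BetaPertH, NOT Clay.  Continuum YM on T⁴ ⇐ BetaPertH ∧ nine spine estimates (0/9 proved); BetaPertH ⇐ (D1) ∧ (D4) ∧ CAP+tail; G-an2-4 gates asym, D1 and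
NE2/3/4.
-/

set_option autoImplicit false

open scoped BigOperators Matrix.Norms.L2Operator
open Finset

namespace Summit.QuantumFields.BalabanUV.T4Continuum.NE7EnergySliceDivergenceSup

open Literature.MathematicalPhysics.QuantumFieldTheory.Balaban1983to89
open B7Prop1Explicit B7Prop2Explicit
open T4AveragingDeficitWall (IsUnitaryCfg IsSkewDir SmallField Ad)
open T4AveragingDeficitWallBoundary (IsPeriodicCfg periodBox mem_periodBox card_periodBox)
open AveragingDeficitPeriodicCounting (IsPeriodicDir)
open AveragingDeficitTransport (norm_Ad_of_unitary)
open AveragingDeficitTwoLevelPrep (prop1Radius)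
open AveragingDeficitMultiLevelPrep (LevelSmall tower)
open AveragingDeficitBlockDensity (btree btree_mem)
open NE3CovariantWeitzenbock (covDiv)
open NE3CovariantBlockMean (bmeanW bmeanIterW bmeanIterW_skew_periodic)
open NE3CovariantBlockDivergence (farFlux nearFlux combDefect farDefect sum_Ad_btree_covDiv_eq btree_corner_add norm_combDefect_le norm_farDefect_le)
open NE3NestedBlockMeanBridge (norm_bmeanIterW_sub_bmeanW_le)
open NE3BlockLineAverage (sum_univ_boxVec)
open NE3LandauOrbit (covDiv_add_period)
open NE3CurvedCornerGaugeSpace (covDiv_mem_skewAdjoint)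
open NE7NestedCovariantExtension (nestedExt norm_nestedExt_le)
open NE7MeanZeroGaugeSliceW (energyBlockLandauW)
open NE7EnergySliceLocalForm (covDiv_eq_nestedExt_of_mem)
open SpreadLift (loopRad)
open NE3CovariantLineSumsError (iterate_prop1Radius_nonneg)
open PeriodicChoice (apply_wrap_eq wrap_mem_periodBox)

noncomputable section

variable {d : ℕ} {n : Type*} [Fintype n] [DecidableEq n]

/-! ## §1 The transported block mean of a covariant divergence is a boundary flux plus first-order defects -/

/-- a sum of `M^{d−1}` unitary transports of bond values of size `≤ S` has norm `≤ M^{d−1}·S`. [folklore] -/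
theorem norm_sum_face_le [Nonempty n] {M : ℕ} (κ : Fin d) {S : ℝ}
    (u : ({j : Fin d // j ≠ κ} → Fin M) → (Matrix n n ℂ)ˣ) (hu : ∀ r', u r' ∈ unitaryUnits (Matrix n n ℂ))
    (X : ({j : Fin d // j ≠ κ} → Fin M) → Matrix n n ℂ) (hX : ∀ r', ‖X r'‖ ≤ S) :
    ‖∑ r' : {j : Fin d // j ≠ κ} → Fin M, Ad (u r') (X r')‖ ≤ (M : ℝ) ^ (d - 1) * S := by
  have hcard : Fintype.card ({j : Fin d // j ≠ κ} → Fin M) = M ^ (d - 1) := by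
    rw [Fintype.card_fun, Fintype.card_fin, Fintype.card_subtype_compl, Fintype.card_fin, Fintype.card_unique]
  calc ‖∑ r' : {j : Fin d // j ≠ κ} → Fin M, Ad (u r') (X r')‖
      ≤ ∑ r' : {j : Fin d // j ≠ κ} → Fin M, ‖Ad (u r') (X r')‖ := norm_sum_le _ _
    _ ≤ ∑ _r' : {j : Fin d // j ≠ κ} → Fin M, S := Finset.sum_le_sum fun r' _ => by rw [norm_Ad_of_unitary (hu r')]; exact hX r'
    _ = (M : ℝ) ^ (d - 1) * S := by
        rw [Finset.sum_const, Finset.card_univ, hcard, nsmul_eq_mul]; push_cast; ring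

/-- the transported `M`-block mean in the tree's `btree` form: `bmeanW M W μ z = M^{−d}·Σ_{v∈[0,M)^d} Ad_{btree M W z (M•z+v)} μ(M•z+v)`. [folklore] -/
theorem bmeanW_eq_sum_btree (M : ℕ) (W : Site d → Fin d → (Matrix n n ℂ)ˣ) (mu : Site d → Matrix n n ℂ) (z : Site d) :
    bmeanW M W mu z = (((M : ℝ) ^ d)⁻¹ : ℝ) • ∑ v ∈ periodBox (d := d) M, Ad (btree M W z ((M : ℤ) • z + v)) (mu ((M : ℤ) • z + v)) := by
  unfold bmeanW
  rw [← Finset.smul_sum, ← sum_univ_boxVec M (fun v => Ad (btree M W z ((M : ℤ) • z + v)) (mu ((M : ℤ) • z + v)))]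
  congr 1
  refine Finset.sum_congr rfl fun r _ => ?_
  rw [btree_corner_add]

/-- **THE TRANSPORTED BLOCK MEAN OF A COVARIANT DIVERGENCE IS `O(S∕M)`** (any bond field `η` with `‖η‖ ≤ S`, any unitary `W` with `SmallField W a`, `a ≥ 0`, any block side
`M ≥ 1`, dimension `d ≥ 1`): `‖bmeanW M W (covDiv W η) z‖ ≤ (2d + 4d(d−1)·(M−1)M·a)·S∕M` — the boundary flux `2d·M^{d−1}·S` plus row NE3's first-order loop defects, over `M^d`.
[folklore] -/
theorem norm_bmeanW_covDiv_le [Nonempty n] (hd : 1 ≤ d) {M : ℕ} (hM : 1 ≤ M) {W : Site d → Fin d → (Matrix n n ℂ)ˣ} (hW : IsUnitaryCfg W)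
    {a : ℝ} (ha : 0 ≤ a) (hWa : SmallField W a) {η : Site d → Fin d → Matrix n n ℂ} {S : ℝ} (hS : ∀ y μ, ‖η y μ‖ ≤ S) (z : Site d) :
    ‖bmeanW M W (covDiv W η) z‖ ≤ (2 * d + 4 * d * ((d : ℝ) - 1) * (((M : ℝ) - 1) * M * a)) * S / M := by
  have hS0 : 0 ≤ S := (norm_nonneg _).trans (hS 0 ⟨0, hd⟩)
  have hM0 : (0 : ℝ) < M := by exact_mod_cast (by omega : 0 < M)
  have hMd : (0 : ℝ) < (M : ℝ) ^ d := by positivity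
  have hd1 : (1 : ℝ) ≤ d := by exact_mod_cast hd
  have hM1 : (1 : ℝ) ≤ M := by exact_mod_cast hM
  have hpow : (M : ℝ) ^ d = (M : ℝ) ^ (d - 1) * M := by
    rw [← pow_succ, Nat.sub_add_cancel hd]
  have hdm : 0 ≤ (d : ℝ) - 1 := by linarith
  have hMm : 0 ≤ (M : ℝ) - 1 := by linarith
  -- the identity (A)
  rw [bmeanW_eq_sum_btree, sum_Ad_btree_covDiv_eq, norm_smul, Real.norm_eq_abs, abs_of_pos (inv_pos.mpr hMd)]
  -- the four bounds
  have hfar : ∀ κ, ‖farFlux W M η z κ‖ ≤ (M : ℝ) ^ (d - 1) * S := fun κ =>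
    norm_sum_face_le κ _ (fun r' => hol_mem_of hW _ _) _ (fun r' => hS _ _)
  have hnear : ∀ κ, ‖nearFlux W M η z κ‖ ≤ (M : ℝ) ^ (d - 1) * S := fun κ =>
    norm_sum_face_le κ _ (fun r' => btree_mem hW M z _) _ (fun r' => hS _ _)
  have hfarD : ∀ κ, ‖farDefect W M η z κ‖ ≤ 2 * (((d : ℝ) - 1) * ((M : ℝ) - 1) * M * a) * ((M : ℝ) ^ (d - 1) * S) := by
    intro κ
    refine (norm_farDefect_le hW ha hWa hM η z κ).trans (mul_le_mul_of_nonneg_left ?_ (by positivity))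
    have hcardκ : Fintype.card ({j : Fin d // j ≠ κ} → Fin M) = M ^ (d - 1) := by
      rw [Fintype.card_fun, Fintype.card_fin, Fintype.card_subtype_compl, Fintype.card_fin, Fintype.card_unique]
    calc ∑ r' : {j : Fin d // j ≠ κ} → Fin M, ‖η ((M : ℤ) • z + NE3StraightAverageAdjoint.tbase κ r' + ((M : ℤ) - 1) • e κ) κ‖
        ≤ ∑ _r' : {j : Fin d // j ≠ κ} → Fin M, S := Finset.sum_le_sum fun r' _ => hS _ _
      _ = (M : ℝ) ^ (d - 1) * S := by rw [Finset.sum_const, Finset.card_univ, hcardκ, nsmul_eq_mul]; push_cast; ring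
  have hcomb : ‖combDefect W M η z‖ ≤ 2 * (((d : ℝ) - 1) * ((M : ℝ) - 1) * a) * ((M : ℝ) ^ d * (d * S)) := by
    refine (norm_combDefect_le hW ha hWa η z).trans (mul_le_mul_of_nonneg_left ?_ (by positivity))
    calc ∑ v ∈ periodBox (d := d) M, ∑ μ : Fin d, ‖η ((M : ℤ) • z + v) μ‖
        ≤ ∑ v ∈ periodBox (d := d) M, ∑ _μ : Fin d, S := Finset.sum_le_sum fun v _ => Finset.sum_le_sum fun μ _ => hS _ _
      _ = (M : ℝ) ^ d * (d * S) := by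
          simp only [Finset.sum_const, Finset.card_univ, Fintype.card_fin, card_periodBox, nsmul_eq_mul]
          push_cast; ring
  -- sum
  have hsumκ : ‖∑ κ : Fin d, (farFlux W M η z κ - farDefect W M η z κ - nearFlux W M η z κ)‖
      ≤ d * ((M : ℝ) ^ (d - 1) * S + 2 * (((d : ℝ) - 1) * ((M : ℝ) - 1) * M * a) * ((M : ℝ) ^ (d - 1) * S) + (M : ℝ) ^ (d - 1) * S) := by
    calc ‖∑ κ : Fin d, (farFlux W M η z κ - farDefect W M η z κ - nearFlux W M η z κ)‖
        ≤ ∑ κ : Fin d, ‖farFlux W M η z κ - farDefect W M η z κ - nearFlux W M η z κ‖ := norm_sum_le _ _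
      _ ≤ ∑ _κ : Fin d, ((M : ℝ) ^ (d - 1) * S + 2 * (((d : ℝ) - 1) * ((M : ℝ) - 1) * M * a) * ((M : ℝ) ^ (d - 1) * S) + (M : ℝ) ^ (d - 1) * S) :=
          Finset.sum_le_sum fun κ _ => (norm_sub_le _ _).trans (add_le_add ((norm_sub_le _ _).trans (add_le_add (hfar κ) (hfarD κ))) (hnear κ))
      _ = _ := by rw [Finset.sum_const, Finset.card_univ, Fintype.card_fin, nsmul_eq_mul]
  have htot := (norm_add_le _ _).trans (add_le_add hsumκ hcomb)
  refine (mul_le_mul_of_nonneg_left htot (inv_pos.mpr hMd).le).trans (le_of_eq ?_)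
  rw [hpow]
  field_simp
  ring

/-! ## §2 The Lagrange multiplier of the energy slice -/

/-- **THE LAGRANGE MULTIPLIER OF `𝒯_E(W)` IS `O(sup∕M)`** (multi-level small-field class at level `k+1`, `L ≥ 2`, `d ≥ 1`, `W` unitary `(tower L N (k+1))`-periodic with
`SmallField W x`, Poincaré parameter `θ_P ≤ 1∕2`): for `Y ∈ energyBlockLandauW L N (k+1) W` with `‖Y‖ ≤ S`, both the nested block mean `g = bmeanIterW L (k+1) W (covDiv W Y)` and
the covariant divergence itself are bounded by `2(2d + 4d(d−1)·(L^{k+1})²x)·S∕L^{k+1}`. [folklore] -/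
theorem divergence_sup_le [Nonempty n] (hd : 1 ≤ d) {L N : ℕ} [NeZero N] (hL : 2 ≤ L) (k : ℕ)
    {W : Site d → Fin d → (Matrix n n ℂ)ˣ} {x : ℝ} (hWu : IsUnitaryCfg W) (hWP : IsPeriodicCfg W ((tower L N (k + 1) : ℕ) : ℤ))
    (hx : 0 ≤ x) (hs : LevelSmall d L k x) (hWx : SmallField W x)
    (hθ : 4 * (d : ℝ) ^ 2 * ((L : ℝ) ^ (k + 1) - 1) ^ 2 * x + 16 * d * loopRad d L ((prop1Radius d L)^[k] x) ≤ 1 / 2)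
    {Y : Site d → Fin d → Matrix n n ℂ} (hY : Y ∈ energyBlockLandauW (d := d) (n := n) L N (k + 1) W)
    {S : ℝ} (hS : ∀ y μ, ‖Y y μ‖ ≤ S) :
    (∀ z, ‖bmeanIterW L (k + 1) W (covDiv W Y) z‖ ≤ 2 * (2 * d + 4 * d * ((d : ℝ) - 1) * (((L : ℝ) ^ (k + 1)) ^ 2 * x)) * S / (L : ℝ) ^ (k + 1)) ∧
    (∀ y, ‖covDiv W Y y‖ ≤ 2 * (2 * d + 4 * d * ((d : ℝ) - 1) * (((L : ℝ) ^ (k + 1)) ^ 2 * x)) * S / (L : ℝ) ^ (k + 1)) := by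
  have hL1 : 1 ≤ L := by omega
  have hN1 : 1 ≤ N := Nat.one_le_iff_ne_zero.mpr (NeZero.ne N)
  have hM1 : 1 ≤ L ^ (k + 1) := Nat.one_le_pow _ _ hL1
  have hMr : ((L ^ (k + 1) : ℕ) : ℝ) = (L : ℝ) ^ (k + 1) := by push_cast; ring
  have hM0 : (0 : ℝ) < (L : ℝ) ^ (k + 1) := by rw [← hMr]; exact_mod_cast (by omega : 0 < L ^ (k + 1))
  have hM1r : (1 : ℝ) ≤ (L : ℝ) ^ (k + 1) := by rw [← hMr]; exact_mod_cast hM1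
  have hS0 : 0 ≤ S := (norm_nonneg _).trans (hS 0 ⟨0, hd⟩)
  have hd1 : (1 : ℝ) ≤ d := by exact_mod_cast hd
  set ξ := covDiv W Y with hξ
  set g := bmeanIterW L (k + 1) W ξ with hg
  -- `ξ` is skew and periodic, so `g` is `N`-periodic and its sup is attained
  have hξs : ∀ y, ξ y ∈ skewAdjoint (Matrix n n ℂ) := fun y => covDiv_mem_skewAdjoint hWu hY.1 y
  have hξP : ∀ (y : Site d) (i : Fin d), ξ (y + ((tower L N (k + 1) : ℕ) : ℤ) • e i) = ξ y := fun y i => covDiv_add_period hWP hY.2.1 y i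
  have hgP : ∀ (z : Site d) (i : Fin d), g (z + (N : ℤ) • e i) = g z := (bmeanIterW_skew_periodic hL1 k hWu hWP hx hs hWx hξs hξP).2
  have hne : (periodBox (d := d) N).Nonempty := ⟨_, wrap_mem_periodBox N hN1 0⟩
  obtain ⟨z₁, -, hz₁⟩ := Finset.exists_max_image _ (fun z : Site d => ‖g z‖) hne
  set Γ : ℝ := ‖g z₁‖ with hΓ
  have hΓall : ∀ z, ‖g z‖ ≤ Γ := fun z => by
    have hw := apply_wrap_eq (g := g) hgP z
    rw [← hw]
    exact hz₁ _ (wrap_mem_periodBox N hN1 z)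
  have hΓ0 : 0 ≤ Γ := norm_nonneg _
  -- the local form: `ξ = nestedExt g`, so `‖ξ‖ ≤ Γ`
  have hξΓ : ∀ y, ‖ξ y‖ ≤ Γ := fun y => by
    rw [hξ, covDiv_eq_nestedExt_of_mem hL1 k hWu hWP hx hs hWx hY y]
    exact norm_nestedExt_le hL1 k hWu hx hs hWx hΓall y
  -- the bridge at `z₁`
  have hbr := norm_bmeanIterW_sub_bmeanW_le hL k hWu hx hs hWx ξ z₁
  have hmean : (((L ^ (k + 1) : ℕ) : ℝ) ^ d)⁻¹ * ∑ v ∈ periodBox (d := d) (L ^ (k + 1)), ‖ξ (((L ^ (k + 1) : ℕ) : ℤ) • z₁ + v)‖ ≤ Γ := by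
    have hMd : (0 : ℝ) < ((L ^ (k + 1) : ℕ) : ℝ) ^ d := by rw [hMr]; positivity
    rw [inv_mul_le_iff₀ hMd]
    calc ∑ v ∈ periodBox (d := d) (L ^ (k + 1)), ‖ξ (((L ^ (k + 1) : ℕ) : ℤ) • z₁ + v)‖
        ≤ ∑ _v ∈ periodBox (d := d) (L ^ (k + 1)), Γ := Finset.sum_le_sum fun v _ => hξΓ _
      _ = ((L ^ (k + 1) : ℕ) : ℝ) ^ d * Γ := by rw [Finset.sum_const, card_periodBox, nsmul_eq_mul]; push_cast; ring
  have hθ0 : 0 ≤ 4 * (d : ℝ) ^ 2 * ((L : ℝ) ^ (k + 1) - 1) ^ 2 * x + 16 * d * loopRad d L ((prop1Radius d L)^[k] x) := by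
    have hr : 0 ≤ (prop1Radius d L)^[k] x := iterate_prop1Radius_nonneg k hx
    have hl : 0 ≤ loopRad d L ((prop1Radius d L)^[k] x) := by unfold loopRad; positivity
    positivity
  have hbr' : ‖g z₁ - bmeanW (L ^ (k + 1)) W ξ z₁‖ ≤ 1 / 2 * Γ :=
    hbr.trans ((mul_le_mul_of_nonneg_left hmean hθ0).trans (mul_le_mul_of_nonneg_right hθ (norm_nonneg _)))
  -- §1 at `z₁`
  have h1 := norm_bmeanW_covDiv_le hd hM1 hWu hx hWx (η := Y) hS z₁
  rw [hMr] at h1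
  -- absorb
  set c : ℝ := 2 * d + 4 * d * ((d : ℝ) - 1) * (((L : ℝ) ^ (k + 1)) ^ 2 * x) with hc
  have hc' : (2 * d + 4 * d * ((d : ℝ) - 1) * (((L : ℝ) ^ (k + 1) - 1) * (L : ℝ) ^ (k + 1) * x)) * S / (L : ℝ) ^ (k + 1) ≤ c * S / (L : ℝ) ^ (k + 1) := by
    refine div_le_div_of_nonneg_right (mul_le_mul_of_nonneg_right ?_ hS0) hM0.le
    have h4 : 0 ≤ 4 * (d : ℝ) * ((d : ℝ) - 1) := by nlinarith
    have hle : ((L : ℝ) ^ (k + 1) - 1) * (L : ℝ) ^ (k + 1) * x ≤ ((L : ℝ) ^ (k + 1)) ^ 2 * x := by nlinarith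
    nlinarith [mul_le_mul_of_nonneg_left hle h4]
  have hkey : Γ ≤ 1 / 2 * Γ + c * S / (L : ℝ) ^ (k + 1) := by
    have e : g z₁ = (g z₁ - bmeanW (L ^ (k + 1)) W ξ z₁) + bmeanW (L ^ (k + 1)) W ξ z₁ := by abel
    calc Γ = ‖g z₁‖ := rfl
      _ ≤ ‖g z₁ - bmeanW (L ^ (k + 1)) W ξ z₁‖ + ‖bmeanW (L ^ (k + 1)) W ξ z₁‖ := by rw [e]; exact (norm_add_le _ _).trans (by rw [← e])
      _ ≤ 1 / 2 * Γ + c * S / (L : ℝ) ^ (k + 1) := add_le_add hbr' (h1.trans hc')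
  have hΓle : Γ ≤ 2 * c * S / (L : ℝ) ^ (k + 1) := by
    have : Γ ≤ 2 * (c * S / (L : ℝ) ^ (k + 1)) := by linarith
    refine this.trans (le_of_eq ?_); ring
  exact ⟨fun z => (hΓall z).trans hΓle, fun y => (hξΓ y).trans hΓle⟩

end

end Summit.QuantumFields.BalabanUV.T4Continuum.NE7EnergySliceDivergenceSup
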